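import Mathlib
import Summits.AtomisticToContinuum.HydrodynamicLimit.Theses.AntiMazurCoboundaries

/-!
# Crux `CorrectorPressureDecay` (stmt-AtomisticToContinuum-14135) — ideator 2, round 1: first lemmas

Two crux idea cards (`kinetic-entropy-collision-budget`, `velocity-chain-rule-split`); this file
states their FIRST LEMMAS as `Prop`s over Mathlib / tree declarations (no proofs required at the
crux-ideate stage; every decl below is expected provable now, sizes noted in the cards).

Common frame.  `G_N = localGibbsLaw σ a u₀ θ N Φ` is, up to normalisation, `Ξ_N(dx) ⊗ γ^{⊗(N+1)}(dv)`:
hard-core positions times i.i.d. Maxwellian velocities, velocities independent of positions.  Both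
cards exploit this EXACT velocity product structure; the abstract lemmas are therefore stated for a
reference measure `ν.prod (Measure.pi fun _ => γ)` on `X × (Fin n → V)`.
-/

namespace Summit.AtomisticToContinuum.HydrodynamicLimit.Cruxes.CorrectorPressureDecay.IdeatorTwo

open scoped BigOperators ENNReal
open MeasureTheory ProbabilityTheory InformationTheory Set Filter

/-! ## Card A — `kinetic-entropy-collision-budget` -/

/-- FIRST LEMMA (card A): the ONE-BODY ENTROPY BUDGET.  For any probability law `P` on
`X × (Fin n → V)` and the reference `ν ⊗ γ^{⊗n}`, the relative entropies of the `n` velocity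
marginals add up to at most the total relative entropy:
`∑ᵢ KL(P^{vᵢ} ‖ γ) ≤ KL(P ‖ ν ⊗ γ^{⊗n})`.
(Chain rule + superadditivity of KL over a PRODUCT reference + joint convexity; the finite-N,
product-reference form of "chaotic densities minimise Boltzmann's entropy at fixed marginals",
Golse–Olla foreword to Rezakhanlou–Villani 2008 pp. vi–viii.)  Applied to `P = (Φ_t)_# (ρ G_N)`,
whose KL to `G_N` is constant in `t` (Liouville + invariance of `G_N`), it says: the one-body
velocity marginal of ANY state of specific relative entropy `ε` stays within relative entropy `ε`
of the Maxwellian FOR ALL TIMES — the a-priori, time-uniform budget of the card. [difficulty: M] -/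
def VelocityEntropyBudget : Prop :=
  ∀ (X V : Type) [MeasurableSpace X] [MeasurableSpace V] (n : ℕ) (ν : Measure X) (γ : Measure V)
    [IsProbabilityMeasure ν] [IsProbabilityMeasure γ] (P : Measure (X × (Fin n → V)))
    [IsProbabilityMeasure P],
    (∑ i : Fin n, klDiv (P.map fun p => p.2 i) γ)
      ≤ klDiv P (ν.prod (Measure.pi fun _ : Fin n => γ))

/-- Card A, first lemma, sharper form actually used (budget CONDITIONAL on a coarse position
label, e.g. the macroscopic cell of the particle, so that the spatial weight `φ` of the flux can be
frozen on cells): for any measurable label `c : X × (Fin n → V) → Fin n → L` of each particle that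
does not depend on that particle's velocity coordinate, the label-conditional velocity entropies
still add up to at most the total.  Stated in the disintegration-free form
`∑ᵢ KL((cᵢ, vᵢ)_# P ‖ (cᵢ)_# P ⊗ γ) ≤ KL(P ‖ ν ⊗ γ^{⊗n})`. [difficulty: M] -/
def CellConditionalVelocityEntropyBudget : Prop :=
  ∀ (X V L : Type) [MeasurableSpace X] [MeasurableSpace V] [MeasurableSpace L]
    [MeasurableSingletonClass L] [Fintype L] (n : ℕ)
    (ν : Measure X) (γ : Measure V) [IsProbabilityMeasure ν] [IsProbabilityMeasure γ]
    (P : Measure (X × (Fin n → V))) [IsProbabilityMeasure P]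
    (c : X → Fin n → L), Measurable c →
    (∑ i : Fin n,
        klDiv (P.map fun p => (c p.1 i, p.2 i))
              ((P.map fun p => c p.1 i).prod γ))
      ≤ klDiv P (ν.prod (Measure.pi fun _ : Fin n => γ))

/-- Card A, structural lemma (provable now, pure convexity; no dynamics): THE WINDOW PRESSURE IS
DRIVEN BY THE ENDPOINT BIAS.  For any bounded jointly measurable process `F : ℝ → Ω → ℝ` on a
probability space and the exponential window functional
`u(T) := log ∫ exp((2/T) ∫₀ᵀ F_t dt) dμ`, one has for `0 < T₀ ≤ T`
`T·u(T) ≤ T₀·u(T₀) + 2 ∫_{T₀}^{T} b(s) ds`, where `b(s) := E_{ρ_s}[F_s]` is the mean of the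
ENDPOINT value under the window-tilted law `ρ_s ∝ exp((2/s)∫₀ˢ F_t dt) μ`
(proof: `(T u)' = u + T u'`, `u' = E_{ρ_T}[∂_T((2/T)A_T)]`, and `u ≤ (2/T) E_{ρ_T}[A_T]` by the
Gibbs variational principle).  With `F_t = F ∘ Φ_t`, `μ = G_N` invariant, `b(s)` is the present
one-body `g`-bias of the CAUSAL state tilted by its past window `[-s, 0]`; hence
`CorrectorPressureDecay ⇐` "Cesàro-vanishing endpoint bias, uniformly in N" — a first-moment,
one-body statement, which is what the entropy-production machinery of the card bounds.
[difficulty: M] -/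
def EndpointBiasInequality : Prop :=
  ∀ (Ω : Type) [MeasurableSpace Ω] (μ : Measure Ω) [IsProbabilityMeasure μ] (F : ℝ → Ω → ℝ),
    Measurable (Function.uncurry F) → (∃ C : ℝ, ∀ t z, |F t z| ≤ C) →
    ∀ (T₀ T : ℝ), 0 < T₀ → T₀ ≤ T →
      T * Real.log (∫ z, Real.exp ((2 / T) * ∫ t in (0 : ℝ)..T, F t z) ∂μ)
        ≤ T₀ * Real.log (∫ z, Real.exp ((2 / T₀) * ∫ t in (0 : ℝ)..T₀, F t z) ∂μ)
          + 2 * ∫ s in T₀..T,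
              (∫ z, F s z * Real.exp ((2 / s) * ∫ t in (0 : ℝ)..s, F t z) ∂μ)
                / (∫ z, Real.exp ((2 / s) * ∫ t in (0 : ℝ)..s, F t z) ∂μ)

/-! ## Card B — `velocity-chain-rule-split` -/

/-- FIRST LEMMA (card B): the ANOVA CROSS TERMS VANISH.  Under `ν ⊗ γ^{⊗n}` with `∫ g dγ = 0`,
a one-body flux term `φ(x) g(vᵢ)` is orthogonal to every bounded function of `(x, vⱼ)` with
`j ≠ i`.  Consequence (the card's L² identity): for `F = ∑ᵢ φᵢ(x) g(vᵢ)` and any bounded `X`,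
`⟨F, X⟩ = ∑ᵢ ⟨φᵢ g(vᵢ), E[X | x, vᵢ]⟩` — the flux autocorrelation `(N+1)⁻¹ Cov_G(F, F∘Φ_u)`
sees only the FIRST-ORDER velocity-Hoeffding component of the evolved flux, i.e. the annealed
one-particle response `v ↦ E_G[F∘Φ_u | x, vᵢ = v]` (all other velocities fresh Maxwellian).
[difficulty: S/M — Fubini] -/
def AnovaCrossTermsVanish : Prop :=
  ∀ (X V : Type) [MeasurableSpace X] [MeasurableSpace V] (n : ℕ) (ν : Measure X) (γ : Measure V)
    [IsProbabilityMeasure ν] [IsProbabilityMeasure γ] (φ : X → ℝ) (g : V → ℝ) (h : X → V → ℝ)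
    (i j : Fin n), i ≠ j →
    Measurable φ → Measurable g → Measurable (Function.uncurry h) →
    (∃ C : ℝ, ∀ x, |φ x| ≤ C) → (∃ C : ℝ, ∀ v, |g v| ≤ C) → (∃ C : ℝ, ∀ x v, |h x v| ≤ C) →
    ∫ v, g v ∂γ = 0 →
    ∫ p, φ p.1 * g (p.2 i) * h p.1 (p.2 j) ∂(ν.prod (Measure.pi fun _ : Fin n => γ)) = 0

/-- Card B, first lemma, entropy side: the CHAIN-RULE SPLIT of the tilt cost.  For a probability
law `q` on `Fin n → V` (the velocity law of a state, positions quenched) the relative entropy to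
the product Maxwellian dominates the MULTI-INFORMATION of `q` (its KL to the product of its own
marginals) plus the marginal costs:
`KL(q ‖ ⊗ᵢ qᵢ) + ∑ᵢ KL(qᵢ ‖ γ) ≤ KL(q ‖ γ^{⊗n})` (in fact equality when finite).
This is what lets the dual of the crux be split into PRODUCT tilts (priced by `∑ KL(qᵢ‖γ)`,
answered by the annealed ANOVA response of the evolved flux) and a CORRELATION PREMIUM (priced by
the multi-information). [difficulty: M] -/
def MultiInformationChainRule : Prop :=
  ∀ (V : Type) [MeasurableSpace V] (n : ℕ) (γ : Measure V) [IsProbabilityMeasure γ]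
    (q : Measure (Fin n → V)) [IsProbabilityMeasure q],
    klDiv q (Measure.pi fun i : Fin n => q.map fun w => w i)
        + (∑ i : Fin n, klDiv (q.map fun w => w i) γ)
      ≤ klDiv q (Measure.pi fun _ : Fin n => γ)

/-- Card B, the QUENCHED REDUCTION in the crux's own frame (provable now from the product
structure of `localGibbsLaw`; stated here only as the shape the line uses — the velocity factor of
`G_N` is the image of `stdGaussian V3` under `w ↦ u₀ + √θ • w`, i.i.d. over particles and
independent of the positions): the window partition function is the position-average of a
VELOCITY-ANNEALED partition function, so that an exponential-moment bound holding for all position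
configurations outside a set of super-exponentially small `G_N`-probability implies the bound for
`G_N`.  Abstract form: for `μ = ν ⊗ κ` (product of probability measures) and bounded measurable
`A`, if `∫ exp(A(x,·)) dκ ≤ exp B` for all `x ∉ S` with `ν S ≤ η`, then
`∫ exp A dμ ≤ exp B + η · exp(sup |A|)`. [difficulty: S — Fubini/Tonelli] -/
def QuenchedReduction : Prop :=
  ∀ (X Y : Type) [MeasurableSpace X] [MeasurableSpace Y] (ν : Measure X) (κ : Measure Y)
    [IsProbabilityMeasure ν] [IsProbabilityMeasure κ] (A : X × Y → ℝ), Measurable A →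
    ∀ (C B η : ℝ) (S : Set X), MeasurableSet S → 0 ≤ η → (∀ p, |A p| ≤ C) → ν S ≤ ENNReal.ofReal η →
    (∀ x ∉ S, ∫ y, Real.exp (A (x, y)) ∂κ ≤ Real.exp B) →
    ∫ p, Real.exp (A p) ∂(ν.prod κ) ≤ Real.exp B + η * Real.exp C

end Summit.AtomisticToContinuum.HydrodynamicLimit.Cruxes.CorrectorPressureDecay.IdeatorTwo
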